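import Literature.Analysis.FluidPDE.CylindricalGenerator
import Literature.Analysis.FluidPDE.StatisticalSolutionDirac
import Literature.Analysis.FunctionSpaces.TorusVectorParseval

/-!
# Crux `EnsembleRealization` (stmt-AnomalousDissipation-0215) — line `augmented-lift`,
# sub-stub M1 `stub_augCurrent`, piece (M1b): the synthesized field (theorems only)

Supports stmt-AnomalousDissipation-0215 (stub `stub_augCurrent` of line `augmented-lift`, piece
M1b `stub_augCurrentPathLawTools`). Nothing here closes an item.

For an `L²`-orthonormal family `g₀, …, g_{D-1}` of smooth solenoidal fields on `T³`, the
SYNTHESIZED FIELD `x ↦ θ Σⱼ wⱼ gⱼ x` of a coordinate vector `w ∈ ℝ^D` (the path coordinate of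
the level laws of `stub_augCurrent`): it is smooth and solenoidal, its Fourier coefficients are
the finite combination `θ Σⱼ wⱼ ĝⱼ(k)` (hence continuous and differentiable along curves in
`w`, conjugate symmetric, transversal), its energy is `θ² ‖w‖²` (Bessel bound on every finite
frequency set), and its pairings with `L²` fields are finite sums (Parseval form of
`Σ' Re ⟪â(k), ·⟫`). Packaged as the single theorem `stub_augCurrentFieldTools`.
-/

noncomputable section

set_option linter.dupNamespace false

open MeasureTheory Set Filter Topology Function Metric UnitAddTorus
open scoped BigOperators ENNReal InnerProductSpace RealInnerProductSpace

namespace Summit.AnomalousDissipation.AnomalousDissipation.Theorems.EnsembleRealization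

open Literature.Analysis.FunctionSpaces Literature.Analysis.FunctionSpaces.Torus
open Literature.Analysis.FluidPDE Literature.Analysis.FluidPDE.Torus

variable {D : ℕ} {g : Fin D → UnitAddTorus (Fin 3) → EuclideanSpace ℝ (Fin 3)}

/-! ### Smoothness, incompressibility -/

/-- The synthesized field is smooth. -/
theorem isSmooth_synth (hg : ∀ j, IsSmooth (g j)) (θ : ℝ) (w : EuclideanSpace ℝ (Fin D)) :
    IsSmooth (fun x => θ • ∑ j, w j • g j x) :=
  (isSmooth_sum_smul Finset.univ (fun j => w j) fun j _ => hg j).smul θ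

/-- The synthesized field is divergence free. -/
theorem isDivFree_synth (hg : ∀ j, IsSmooth (g j)) (hgdiv : ∀ j, IsDivFree (g j)) (θ : ℝ)
    (w : EuclideanSpace ℝ (Fin D)) : IsDivFree (fun x => θ • ∑ j, w j • g j x) := by
  have h : (fun x => θ • ∑ j, w j • g j x) = fun x => ∑ j, (θ * w j) • g j x := by
    funext x
    rw [Finset.smul_sum]
    simp_rw [smul_smul]
  rw [h]
  exact IsDivFree.sum_smul Finset.univ (fun j => θ * w j) hg hgdiv

/-! ### Fourier coefficients -/

/-- Fourier coefficients commute with real scalars. -/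
theorem mFourierCoeff_real_smul (r : ℝ) (F : UnitAddTorus (Fin 3) → EuclideanSpace ℂ (Fin 3))
    (k : Fin 3 → ℤ) : mFourierCoeff (fun x => r • F x) k = r • mFourierCoeff F k := by
  simp only [mFourierCoeff, smul_comm _ r, integral_smul]

/-- **Fourier coefficients of the synthesized field**: `𝓕(θ Σⱼ wⱼ gⱼ)(k) = Σⱼ (θ wⱼ) ĝⱼ(k)`. -/
theorem mFourierCoeff_synth_eq_sum (hg : ∀ j, IsSmooth (g j)) (θ : ℝ) (w : EuclideanSpace ℝ (Fin D))
    (k : Fin 3 → ℤ) :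
    mFourierCoeff (EuclideanSpace.complexify ∘ fun x => θ • ∑ j, w j • g j x) k =
      ∑ j, (θ * w j) • mFourierCoeff (EuclideanSpace.complexify ∘ g j) k := by
  have hfun : (EuclideanSpace.complexify ∘ fun x => θ • ∑ j, w j • g j x) =
      fun x => ∑ j, (θ * w j) • (EuclideanSpace.complexify ∘ g j) x := by
    funext x
    simp only [Function.comp_apply, map_smul, map_sum, Finset.smul_sum, smul_smul]
  have h := mFourierCoeff_finset_sum Finset.univ
    (f := fun j y => (θ * w j) • (EuclideanSpace.complexify ∘ g j) y)
    (fun j _ => (integrable_complexify_comp (hg j).integrable).smul (θ * w j)) k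
  simp only at h
  rw [hfun, h]
  exact Finset.sum_congr rfl fun j _ => mFourierCoeff_real_smul _ _ _

/-- The Fourier coefficients of the synthesized field as a continuous linear map of the
coordinates: `𝓕(θ Σⱼ wⱼ gⱼ)(k) = (Σⱼ (θ πⱼ) ⊗ ĝⱼ(k)) w`. -/
theorem mFourierCoeff_synth (hg : ∀ j, IsSmooth (g j)) (θ : ℝ) (w : EuclideanSpace ℝ (Fin D))
    (k : Fin 3 → ℤ) :
    mFourierCoeff (EuclideanSpace.complexify ∘ fun x => θ • ∑ j, w j • g j x) k =
      (∑ j, (θ • EuclideanSpace.proj (𝕜 := ℝ) j).smulRight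
        (mFourierCoeff (EuclideanSpace.complexify ∘ g j) k)) w := by
  rw [mFourierCoeff_synth_eq_sum hg]
  simp [ContinuousLinearMap.smulRight_apply, EuclideanSpace.proj]

/-- The Fourier coefficients of the synthesized field depend continuously (indeed linearly) on
the coordinates. -/
theorem continuous_mFourierCoeff_synth (hg : ∀ j, IsSmooth (g j)) (θ : ℝ) (k : Fin 3 → ℤ) :
    Continuous fun w : EuclideanSpace ℝ (Fin D) =>
      mFourierCoeff (EuclideanSpace.complexify ∘ fun x => θ • ∑ j, w j • g j x) k := by
  simp_rw [mFourierCoeff_synth hg]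
  exact ContinuousLinearMap.continuous _

/-- **Chain rule**: along a curve `w(s)` with velocity `w'`, the Fourier coefficients of the
synthesized field have derivative the coefficients of the field synthesized from `w'`. -/
theorem hasDerivAt_mFourierCoeff_synth (hg : ∀ j, IsSmooth (g j)) (θ : ℝ) (k : Fin 3 → ℤ)
    {w : ℝ → EuclideanSpace ℝ (Fin D)} {w' : EuclideanSpace ℝ (Fin D)} {t : ℝ}
    (hw : HasDerivAt w w' t) :
    HasDerivAt (fun s => mFourierCoeff (EuclideanSpace.complexify ∘ fun x => θ • ∑ j, w s j • g j x) k)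
      (mFourierCoeff (EuclideanSpace.complexify ∘ fun x => θ • ∑ j, w' j • g j x) k) t := by
  simp_rw [mFourierCoeff_synth hg]
  exact (ContinuousLinearMap.hasFDerivAt _).comp_hasDerivAt t hw

/-- The Fourier coefficients of the (real, integrable) synthesized field are conjugate
symmetric. -/
theorem isConjSymm_synth (hg : ∀ j, IsSmooth (g j)) (θ : ℝ) (w : EuclideanSpace ℝ (Fin D)) :
    IsConjSymm fun k => mFourierCoeff (EuclideanSpace.complexify ∘ fun x => θ • ∑ j, w j • g j x) k :=
  isConjSymm_mFourierCoeff (isSmooth_synth hg θ w).integrable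

/-- The Fourier coefficients of the (smooth, solenoidal) synthesized field are transversal. -/
theorem sum_mul_mFourierCoeff_synth (hg : ∀ j, IsSmooth (g j)) (hgdiv : ∀ j, IsDivFree (g j))
    (θ : ℝ) (w : EuclideanSpace ℝ (Fin D)) (k : Fin 3 → ℤ) :
    ∑ i, (k i : ℂ) * mFourierCoeff (EuclideanSpace.complexify ∘ fun x => θ • ∑ j, w j • g j x) k i = 0 :=
  (isDivFree_synth hg hgdiv θ w).sum_mul_mFourierCoeff_eq_zero (isSmooth_synth hg θ w) k

/-! ### Energy -/

/-- **Pairing with the synthesized field is a finite sum**: `∫ ⟪a, θ Σ wⱼ gⱼ⟫ = θ Σⱼ wⱼ ∫ ⟪a, gⱼ⟫`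
for an integrable `a`. -/
theorem integral_inner_synth (hg : ∀ j, IsSmooth (g j)) {a : UnitAddTorus (Fin 3) → EuclideanSpace ℝ (Fin 3)}
    (ha : Integrable a volume) (θ : ℝ) (w : EuclideanSpace ℝ (Fin D)) :
    ∫ x, ⟪a x, θ • ∑ j, w j • g j x⟫_ℝ = θ * ∑ j, w j * ∫ x, ⟪a x, g j x⟫_ℝ := by
  have hint : ∀ j, Integrable (fun x => ⟪a x, g j x⟫_ℝ) volume := fun j =>
    integrable_inner_of_continuous ha (hg j).continuous
  simp_rw [real_inner_smul_right, inner_sum, real_inner_smul_right]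
  rw [integral_const_mul, integral_finsetSum _ fun j _ => (hint j).const_mul (w j)]
  congr 1
  exact Finset.sum_congr rfl fun j _ => integral_const_mul _ _

/-- **Energy of the synthesized field**: `∫ ‖θ Σ wⱼ gⱼ‖² = θ² ‖w‖²` (orthonormality). -/
theorem integral_norm_sq_synth (hg : ∀ j, IsSmooth (g j))
    (horth : ∀ i j, ∫ x, ⟪g i x, g j x⟫_ℝ = if i = j then 1 else 0) (θ : ℝ)
    (w : EuclideanSpace ℝ (Fin D)) :
    ∫ x, ‖θ • ∑ j, w j • g j x‖ ^ 2 = θ ^ 2 * ‖w‖ ^ 2 := by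
  have hsm := isSmooth_synth hg θ w
  have h1 : ∀ x, ‖θ • ∑ j, w j • g j x‖ ^ 2 = ⟪θ • ∑ j, w j • g j x, θ • ∑ j, w j • g j x⟫_ℝ :=
    fun x => (real_inner_self_eq_norm_sq _).symm
  simp_rw [h1]
  rw [integral_inner_synth hg hsm.integrable θ w]
  have h2 : ∀ j, ∫ x, ⟪θ • ∑ i, w i • g i x, g j x⟫_ℝ = θ * w j := fun j => by
    have h3 : ∀ x, ⟪θ • ∑ i, w i • g i x, g j x⟫_ℝ = ⟪g j x, θ • ∑ i, w i • g i x⟫_ℝ :=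
      fun x => real_inner_comm _ _
    simp_rw [h3]
    rw [integral_inner_synth hg (hg j).integrable θ w]
    simp_rw [horth j]
    simp
  simp_rw [h2]
  rw [EuclideanSpace.norm_sq_eq, Finset.mul_sum, Finset.mul_sum]
  refine Finset.sum_congr rfl fun j _ => ?_
  rw [Real.norm_eq_abs, sq_abs]
  ring

/-- **Bessel bound** for the synthesized field on a finite frequency set:
`Σ_{k∈T} ‖𝓕(θ Σ wⱼ gⱼ)(k)‖² ≤ θ² ‖w‖²`. -/
theorem sum_norm_sq_mFourierCoeff_synth_le (hg : ∀ j, IsSmooth (g j))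
    (horth : ∀ i j, ∫ x, ⟪g i x, g j x⟫_ℝ = if i = j then 1 else 0) (θ : ℝ)
    (w : EuclideanSpace ℝ (Fin D)) (T : Finset (Fin 3 → ℤ)) :
    ∑ k ∈ T, ‖mFourierCoeff (EuclideanSpace.complexify ∘ fun x => θ • ∑ j, w j • g j x) k‖ ^ 2 ≤
      θ ^ 2 * ‖w‖ ^ 2 := by
  rw [← integral_norm_sq_synth hg horth θ w]
  exact sum_le_hasSum T (fun k _ => sq_nonneg _)
    (hasSum_sq_norm_mFourierCoeff_complexify ((isSmooth_synth hg θ w).memLp 2))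

/-- **Parseval form of the modewise pairing**: for `a ∈ L²`,
`Σ' Re ⟪â(k), 𝓕(θ Σ wⱼ gⱼ)(k)⟫ = ∫ ⟪a, θ Σ wⱼ gⱼ⟫`. -/
theorem tsum_re_inner_mFourierCoeff_synth (hg : ∀ j, IsSmooth (g j))
    {a : UnitAddTorus (Fin 3) → EuclideanSpace ℝ (Fin 3)} (ha : MemLp a 2 volume) (θ : ℝ)
    (w : EuclideanSpace ℝ (Fin D)) :
    ∑' k, (⟪mFourierCoeff (EuclideanSpace.complexify ∘ a) k,
        mFourierCoeff (EuclideanSpace.complexify ∘ fun x => θ • ∑ j, w j • g j x) k⟫_ℂ).re =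
      ∫ x, ⟪a x, θ • ∑ j, w j • g j x⟫_ℝ :=
  (hasSum_re_inner_mFourierCoeff_complexify ha ((isSmooth_synth hg θ w).memLp 2)).tsum_eq

/-! ### The packaged field tools -/

/-- **Field tools for (M1b).** For an `L²`-orthonormal family of smooth solenoidal fields `gⱼ`
and `θ ∈ ℝ`, the synthesized field `x ↦ θ Σⱼ wⱼ gⱼ x` of `w ∈ ℝ^D`: (i) each Fourier
coefficient is a continuous linear map of `w`; (ii) the coefficients are conjugate symmetric and
(iii) transversal; (iv) Bessel: `Σ_{k∈T} ‖𝓕(·)(k)‖² ≤ θ²‖w‖²`; (v) the pairing with an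
integrable field `a` is a continuous linear functional of `w`; (vi) Parseval:
`Σ' Re⟪â(k), 𝓕(·)(k)⟫ = ∫ ⟪a, ·⟫` for `a ∈ L²`. -/
theorem stub_augCurrentFieldTools {D : ℕ} {g : Fin D → UnitAddTorus (Fin 3) → EuclideanSpace ℝ (Fin 3)}
    (hg : ∀ j, IsSmooth (g j)) (hgdiv : ∀ j, IsDivFree (g j))
    (horth : ∀ i j, ∫ x, ⟪g i x, g j x⟫_ℝ = if i = j then 1 else 0) (θ : ℝ) :
    (∀ k : Fin 3 → ℤ, ∃ T : EuclideanSpace ℝ (Fin D) →L[ℝ] EuclideanSpace ℂ (Fin 3),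
      ∀ w : EuclideanSpace ℝ (Fin D),
        mFourierCoeff (EuclideanSpace.complexify ∘ fun x => θ • ∑ j, w j • g j x) k = T w) ∧
    (∀ w : EuclideanSpace ℝ (Fin D),
      IsConjSymm fun k => mFourierCoeff (EuclideanSpace.complexify ∘ fun x => θ • ∑ j, w j • g j x) k) ∧
    (∀ (w : EuclideanSpace ℝ (Fin D)) (k : Fin 3 → ℤ),
      ∑ i, (k i : ℂ) * mFourierCoeff (EuclideanSpace.complexify ∘ fun x => θ • ∑ j, w j • g j x) k i = 0) ∧
    (∀ (w : EuclideanSpace ℝ (Fin D)) (T : Finset (Fin 3 → ℤ)),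
      ∑ k ∈ T, ‖mFourierCoeff (EuclideanSpace.complexify ∘ fun x => θ • ∑ j, w j • g j x) k‖ ^ 2 ≤
        θ ^ 2 * ‖w‖ ^ 2) ∧
    (∀ a : UnitAddTorus (Fin 3) → EuclideanSpace ℝ (Fin 3), Integrable a volume →
      ∃ ℓ : EuclideanSpace ℝ (Fin D) →L[ℝ] ℝ, ∀ w : EuclideanSpace ℝ (Fin D),
        ∫ x, ⟪a x, θ • ∑ j, w j • g j x⟫_ℝ = ℓ w) ∧
    (∀ a : UnitAddTorus (Fin 3) → EuclideanSpace ℝ (Fin 3), MemLp a 2 volume →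
      ∀ w : EuclideanSpace ℝ (Fin D),
        ∑' k, (⟪mFourierCoeff (EuclideanSpace.complexify ∘ a) k,
            mFourierCoeff (EuclideanSpace.complexify ∘ fun x => θ • ∑ j, w j • g j x) k⟫_ℂ).re =
          ∫ x, ⟪a x, θ • ∑ j, w j • g j x⟫_ℝ) := by
  refine ⟨fun k => ⟨_, fun w => mFourierCoeff_synth hg θ w k⟩, isConjSymm_synth hg θ,
    sum_mul_mFourierCoeff_synth hg hgdiv θ, sum_norm_sq_mFourierCoeff_synth_le hg horth θ,
    fun a ha => ?_, fun _ ha w => tsum_re_inner_mFourierCoeff_synth hg ha θ w⟩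
  refine ⟨∑ j, (θ * ∫ x, ⟪a x, g j x⟫_ℝ) • EuclideanSpace.proj (𝕜 := ℝ) j, fun w => ?_⟩
  rw [integral_inner_synth hg ha θ w, Finset.mul_sum]
  simp only [FunLike.coe_sum, Finset.sum_apply, FunLike.coe_smul,
    Pi.smul_apply, smul_eq_mul, EuclideanSpace.proj, PiLp.proj_apply]
  exact Finset.sum_congr rfl fun j _ => by ring

end Summit.AnomalousDissipation.AnomalousDissipation.Theorems.EnsembleRealization
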